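import Literature.NumberTheory.EllipticCurves.BigGaloisRepSelmer
import HarnessLib

/-!
# Crux 4 `BSDpOnCellC` (stmt-BirchSwinnertonDyer-19034), line «telescope» v10, leaf N2|pub sub-leaf W2 / leaf N3′ — the (ann) input, third brick:
# `ker(H¹(Γ, M₁) → H¹(Γ, M₂))` IS FINITE for a morphism with FINITE COKERNEL whose kernel has FINITE `H¹`
# (successor LEAD `cruxlead-19034` g3; `--supports`, helper; THEOREMS ONLY; generic dévissage; closes no registered stub)

HONEST FRAMING. No registered stub, no crux, no summit statement is proved; BSD is proved for no curve. This is one step of the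
dévissage that will turn N1's (fd₀) quasi-isomorphism `θ₀ : A₂[X] → E[p^∞]` (finite kernel and cokernel) into the finiteness of
`H¹(I_w, A₂[X])[p]` from the tree's `finite_torsionBy_continuousCohomology_one_absInertia` for the DIVISIBLE module `E[p^∞]` — the
remaining input of W2's (ann) after p755236 (`TelescopeK2FrobeniusAnnihilator`) and `TelescopeK2InvariantsQuotToH1`. GENERIC: any
topological group `Γ`, discrete coefficient modules.

* **`finite_setOf_cohomologyMap_one_eq_zero`** — for a morphism `f : ρ₁ → ρ₂` of discrete continuous representations with
  `M₂ / f(M₁)` finite and `H¹(Γ, ker f)` finite (e.g. `Γ = I_F` and `ker f` finite of order prime to the residue characteristic,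
  tree `natCard_continuousCohomology_one_absInertia_le`), the set `{x ∈ H¹(Γ, M₁) | H¹(f) x = 0}` is finite. Proof: the two short
  exact sequences `0 → ker f → M₁ → f(M₁) → 0` and `0 → f(M₁) → M₂ → M₂/f(M₁) → 0` and the tree's exactness lemmas
  `IsSES.exists_map_one_eq_of_map_one_eq_zero` (at `H¹(M₁)`) and `IsSES.exists_δ₀_eq_of_map_one_eq_zero` (at `H¹(f(M₁))`).

References: J.-P. Serre, Cohomologie galoisienne, I §2.2 [SerreGaloisCohomology1997]; J. Milne, Arithmetic Duality Theorems, I §2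
Lemma 2.9 [MilneADT2006].
-/

set_option autoImplicit false
set_option linter.dupNamespace false

noncomputable section

universe u

open Literature.NumberTheory.GaloisRepresentations Literature.NumberTheory.EllipticCurves
  Literature.NumberTheory.EllipticCurves.BigGaloisRep

namespace Summit.BirchSwinnertonDyer.BirchSwinnertonDyer.Theorems.TelescopeK2HOneFiniteKernel

variable {A : Type*} [CommRing A] [TopologicalSpace A]
  {Γ : Type u} [Group Γ] [TopologicalSpace Γ] [IsTopologicalGroup Γ]
  {M₁ : Type u} [AddCommGroup M₁] [Module A M₁] [TopologicalSpace M₁] [DiscreteTopology M₁] [ContinuousSMul A M₁]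
  {M₂ : Type u} [AddCommGroup M₂] [Module A M₂] [TopologicalSpace M₂] [DiscreteTopology M₂] [ContinuousSMul A M₂]
  (ρ₁ : ContinuousRep Γ A M₁) (ρ₂ : ContinuousRep Γ A M₂) (f : ρ₁.toTopRep ⟶ ρ₂.toTopRep)

omit [IsTopologicalGroup Γ] in
/-- The kernel of an equivariant map is stable. [folklore] -/
theorem ker_le_comap (g : Γ) :
    LinearMap.ker f.hom.toLinearMap ≤ (LinearMap.ker f.hom.toLinearMap).comap (ρ₁ g) := by
  intro m hm
  change f.hom m = 0 at hm
  change f.hom (ρ₁ g m) = 0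
  rw [ContinuousRep.hom_comm_apply f g m, hm, map_zero]

omit [IsTopologicalGroup Γ] in
/-- The image of an equivariant map is stable. [folklore] -/
theorem range_le_comap (g : Γ) :
    LinearMap.range f.hom.toLinearMap ≤ (LinearMap.range f.hom.toLinearMap).comap (ρ₂ g) := by
  rintro _ ⟨m, rfl⟩
  refine ⟨ρ₁ g m, ?_⟩
  change f.hom (ρ₁ g m) = ρ₂ g (f.hom m)
  exact ContinuousRep.hom_comm_apply f g m

/-- `H¹` of a composite on classes: `H¹(g)(H¹(h) x) = H¹(k) x` whenever `g ∘ h = k` pointwise. [folklore] -/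
theorem cohomologyMap_comp_apply_of_eq {M₃ : Type u} [AddCommGroup M₃] [Module A M₃] [TopologicalSpace M₃]
    [DiscreteTopology M₃] [ContinuousSMul A M₃] {ρ₃ : ContinuousRep Γ A M₃}
    (h : ρ₁.toTopRep ⟶ ρ₃.toTopRep) (g : ρ₃.toTopRep ⟶ ρ₂.toTopRep) (k : ρ₁.toTopRep ⟶ ρ₂.toTopRep)
    (hcomp : ∀ m, g.hom (h.hom m) = k.hom m) (x : continuousCohomology 1 ρ₁.toTopRep) :
    cohomologyMap g 1 (cohomologyMap h 1 x) = cohomologyMap k 1 x := by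
  obtain ⟨φ, rfl⟩ := oneCocycleClass_surjective _ x
  rw [cohomologyMap_oneCocycleClass, cohomologyMap_oneCocycleClass, cohomologyMap_oneCocycleClass]
  refine congrArg _ (Subtype.ext (ContinuousMap.ext fun σ => ?_))
  rw [contOneCocycles.pullback_apply, contOneCocycles.pullback_apply, contOneCocycles.pullback_apply]
  exact hcomp _

/-- **Finite kernel of `H¹(f)`.** For a morphism `f : ρ₁ → ρ₂` of discrete continuous `Γ`-representations with finite cokernel
`M₂/f(M₁)` and with `H¹(Γ, ker f)` finite, the classes of `H¹(Γ, M₁)` killed by `H¹(f)` form a finite set.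
[cite: SerreGaloisCohomology1997, I §2.2] [cite: MilneADT2006, I §2 Lemma 2.9] -/
theorem finite_setOf_cohomologyMap_one_eq_zero
    (hK : Finite (continuousCohomology 1
      (ρ₁.subrepresentation (LinearMap.ker f.hom.toLinearMap) (ker_le_comap ρ₁ ρ₂ f)).toTopRep))
    (hC : Finite (M₂ ⧸ LinearMap.range f.hom.toLinearMap)) :
    Set.Finite {x : continuousCohomology 1 ρ₁.toTopRep | cohomologyMap f 1 x = 0} := by
  classical
  set K : Submodule A M₁ := LinearMap.ker f.hom.toLinearMap with hKdef
  set R : Submodule A M₂ := LinearMap.range f.hom.toLinearMap with hRdef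
  have hKst : ∀ g, K ≤ K.comap (ρ₁ g) := ker_le_comap ρ₁ ρ₂ f
  have hRst : ∀ g, R ≤ R.comap (ρ₂ g) := range_le_comap ρ₁ ρ₂ f
  let ρK := ρ₁.subrepresentation K hKst
  let ρR := ρ₂.subrepresentation R hRst
  let ρC := ρ₂.quotient R hRst
  -- the four morphisms
  let ιK : ρK.toTopRep ⟶ ρ₁.toTopRep :=
    TopRep.ofHom ⟨⟨K.subtype, continuous_subtype_val⟩, fun σ => by ext m; rfl⟩
  let π : ρ₁.toTopRep ⟶ ρR.toTopRep :=
    TopRep.ofHom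
      { toLinearMap := LinearMap.rangeRestrict f.hom.toLinearMap
        cont := continuous_of_discreteTopology
        isIntertwining' := fun σ => by
          refine ContinuousLinearMap.ext fun m => Subtype.ext ?_
          change f.hom (ρ₁.toTopRep.ρ σ m) = ρ₂ σ (f.hom m)
          exact ContinuousRep.hom_comm_apply f σ m }
  let ιR : ρR.toTopRep ⟶ ρ₂.toTopRep :=
    TopRep.ofHom ⟨⟨R.subtype, continuous_subtype_val⟩, fun σ => by ext m; rfl⟩
  let q : ρ₂.toTopRep ⟶ ρC.toTopRep := ρ₂.mkQHom R hRst
  have hιK : ∀ m : K, ιK.hom m = (m : M₁) := fun _ => rfl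
  have hπ : ∀ m : M₁, ((π.hom m : R) : M₂) = f.hom m := fun _ => rfl
  have hιR : ∀ m : R, ιR.hom m = (m : M₂) := fun _ => rfl
  have hq : ∀ m : M₂, q.hom m = Submodule.Quotient.mk m := fun _ => rfl
  -- the two short exact sequences
  have hSES₁ : IsSES ιK π :=
    { comp_eq_zero := by
        ext m
        change ((π.hom (ιK.hom m) : R) : M₂) = 0
        rw [hπ, hιK]
        exact m.2
      injective := Subtype.val_injective
      exact_mid := fun y hy => by
        have hy' : f.hom y = 0 := by
          have := congrArg (fun r : R => (r : M₂)) hy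
          simpa only [hπ, ZeroMemClass.coe_zero] using this
        exact ⟨⟨y, hy'⟩, rfl⟩
      surjective := fun r => by
        obtain ⟨m, hm⟩ := r.2
        exact ⟨m, Subtype.ext (by rw [hπ]; exact hm)⟩ }
  have hSES₂ : IsSES ιR q :=
    { comp_eq_zero := by
        ext m
        change q.hom (ιR.hom m) = 0
        rw [hq, hιR, Submodule.Quotient.mk_eq_zero]
        exact m.2
      injective := Subtype.val_injective
      exact_mid := fun y hy => by
        rw [hq, Submodule.Quotient.mk_eq_zero] at hy
        exact ⟨⟨y, hy⟩, rfl⟩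
      surjective := fun c => by
        induction c using Submodule.Quotient.induction_on with
        | _ m => exact ⟨m, rfl⟩ }
  -- `H¹(ιR) ∘ H¹(π) = H¹(f)`
  have hcomp : ∀ x : continuousCohomology 1 ρ₁.toTopRep,
      cohomologyMap ιR 1 (cohomologyMap π 1 x) = cohomologyMap f 1 x :=
    cohomologyMap_comp_apply_of_eq ρ₁ ρ₂ π ιR f (fun m => rfl)
  -- finitely many values of `H¹(π)` on the kernel: they lie in the image of `δ₀` of the second sequence
  haveI : Finite ρC.toTopRep.ρ.invariants := Finite.of_injective (fun v => (v : M₂ ⧸ R)) Subtype.val_injective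
  set T : Set (continuousCohomology 1 ρR.toTopRep) := Set.range hSES₂.δ₀ with hTdef
  have hTfin : T.Finite := Set.finite_range _
  have hval : ∀ x : continuousCohomology 1 ρ₁.toTopRep, cohomologyMap f 1 x = 0 → cohomologyMap π 1 x ∈ T := by
    intro x hx
    obtain ⟨v, hv⟩ := hSES₂.exists_δ₀_eq_of_map_one_eq_zero (cohomologyMap π 1 x) (by rw [hcomp, hx])
    exact ⟨v, hv⟩
  -- finite fibres: two classes with the same image under `H¹(π)` differ by a class from `H¹(Γ, ker f)`
  haveI := hK
  have hfib : ∀ y ∈ T, Set.Finite {x : continuousCohomology 1 ρ₁.toTopRep | cohomologyMap f 1 x = 0 ∧ cohomologyMap π 1 x = y} := by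
    intro y hy
    by_cases hne : {x : continuousCohomology 1 ρ₁.toTopRep | cohomologyMap f 1 x = 0 ∧ cohomologyMap π 1 x = y}.Nonempty
    · obtain ⟨x₁, hx₁0, hx₁y⟩ := hne
      refine (Set.finite_range fun z : continuousCohomology 1 ρK.toTopRep => x₁ + cohomologyMap ιK 1 z).subset ?_
      rintro x ⟨hx0, hxy⟩
      obtain ⟨z, hz⟩ := hSES₁.exists_map_one_eq_of_map_one_eq_zero (x - x₁) (by rw [map_sub, hxy, hx₁y, sub_self])
      refine ⟨z, ?_⟩
      change x₁ + cohomologyMap ιK 1 z = x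
      rw [hz, add_sub_cancel]
    · rw [Set.not_nonempty_iff_eq_empty] at hne
      rw [hne]
      exact Set.finite_empty
  refine (hTfin.biUnion hfib).subset fun x hx => ?_
  rw [Set.mem_iUnion₂]
  exact ⟨cohomologyMap π 1 x, hval x hx, hx, rfl⟩

end Summit.BirchSwinnertonDyer.BirchSwinnertonDyer.Theorems.TelescopeK2HOneFiniteKernel

end
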